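import Literature.MathematicalPhysics.KineticTheory.InfiniteChainCurrentPositiveType
import Literature.MathematicalPhysics.KineticTheory.InfiniteChainTwoPointContinuity
import Literature.MathematicalPhysics.KineticTheory.InfiniteChainGibbsInvariance
import Literature.MathematicalPhysics.KineticTheory.InfiniteChainShiftInvariantUniqueness
import Literature.MathematicalPhysics.KineticTheory.InfiniteChainEnergyDensityMoments
import Literature.MathematicalPhysics.KineticTheory.ZeroWavenumberDataOfClustering
import Summits.AtomisticToContinuum.FouriersLaw.Theorems.CageBudgetFeketeHeatVarianceCalculusLaplace
import HarnessLib

/-!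
# Stub `stub_bochnerPositivity` of line `Sketch` (canonical reduction), crux
`HoelderEscapeProfile.FibreCalculus` (item stmt-AtomisticToContinuum-16011; `--supports` file)

BOCHNER POSITIVITY of the Abel escape profile of the pinned anharmonic chain, for the CANONICAL
Buttà–Marchioro dynamics `D` (carrier `bmGood`, measurable flow, identity off `bmGood`) in its
shift-invariant DLR state `μ`: with `S(x,t) = Cov_μ(h_0, h_x ∘ φ_t)`, `S̄_ν(x) = ν∫₀^∞ e^{-νt}S(x,t)dt`
(Laplace integrability of `S(x,·)` and `Σ_x |S̄_ν(x)| < ∞` are hypotheses),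
`f̂_ν(k) = Σ_x cos(kx) S̄_ν(x) ≥ 0` for all `ν > 0` and all real `k`.

Proof (no spectral theorem):
* `x ↦ S̄_ν(x)` is POSITIVE-DEFINITE on `ℤ` (`bp_sum_sum_laplace_nonneg`): for a finite real family `c`,
  `Σ_{x,y} c_x c_y S̄_ν(y-x) = ν ∫₀^∞ e^{-νt} F(t) dt` with `F(t) = ∫ g (g ∘ φ_t) dμ`, `g = Σ_x c_x (h_x - μ(h_0))`
  (shift covariance `∫ h̃_x (h̃_y∘φ_t) = S(y-x,t)`, `bp_integral_centred_mul_flow_eq`, from shift invariance of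
  `μ` and `InfiniteChainDynamics.flow_chainShift_of_eq_id`), and the ABEL MEAN of an autocorrelation along a
  measure-preserving flow is `≥ 0` (`bp_integral_exp_neg_mul_autocorr_nonneg`): `F` is continuous
  (`InfiniteChainDynamics.continuous_integral_mul_comp_flow`), bounded, and
  `∫_{(0,t]} (t-u)F(u)du ≥ 0` (`InfiniteChainDynamics.integral_Ioc_sub_mul_nonneg`), whence
  `∫e^{-νt}F = ν² ∫ e^{-νt} ∫_{(0,t]}(t-u)F(u)du dt ≥ 0` by the Laplace calculus
  `HeatVarianceCalculus.CanonicalRigidity.stub_laplaceHeatVariance` (in tree).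
* FEJÉR (`bp_tsum_cos_mul_nonneg`): with `c = cos(k·)` and `c = sin(k·)` on `[0,n)`,
  `0 ≤ n⁻¹ Σ_{i,j<n} cos(k(j-i)) S̄_ν(j-i) = Σ_d (N_n(d)/n) cos(kd) S̄_ν(d) → f̂_ν(k)` (dominated convergence,
  counting lemmas of `FluctuationFoelnerPositivity`).
-/

noncomputable section

namespace Summit.AtomisticToContinuum.FouriersLaw.Theorems.FibreCalculusSketch

open MeasureTheory ProbabilityTheory Filter Topology Set Function
open Literature.MathematicalPhysics.KineticTheory.HeatConduction

/-! ## Pure analysis: Abel means of positive-type functions, Fejér on `ℤ` -/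

/-- **Abel mean of a function of positive type (doubly integrated form).** For continuous bounded
`C` with `∫_{(0,t]} (t-s) C(s) ds ≥ 0` for all `t ≥ 0`: `∫_{(0,∞)} e^{-νt} C(t) dt ≥ 0` for `ν > 0`
(`= (ν²/2) ∫ e^{-νt} · 2∫_{(0,t]}(t-s)C(s)ds dt`, `stub_laplaceHeatVariance`). [folklore] -/
theorem bp_integral_exp_neg_mul_nonneg {C : ℝ → ℝ} (hC : Continuous C) (hM : ∃ M : ℝ, ∀ t, |C t| ≤ M)
    (hpos : ∀ t : ℝ, 0 ≤ t → 0 ≤ ∫ s in Ioc (0:ℝ) t, (t - s) * C s) {ν : ℝ} (hν : 0 < ν) :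
    0 ≤ ∫ t in Ioi (0:ℝ), Real.exp (-(ν * t)) * C t := by
  obtain ⟨-, -, h⟩ :=
    Summit.AtomisticToContinuum.FouriersLaw.Theorems.HeatVarianceCalculus.CanonicalRigidity.stub_laplaceHeatVariance
      C hC hM _ rfl ν hν
  rw [h]
  refine mul_nonneg (by positivity) (setIntegral_nonneg measurableSet_Ioi fun t ht => ?_)
  exact mul_nonneg (Real.exp_pos _).le (mul_nonneg zero_le_two (hpos t (le_of_lt ht)))

/-- **Fejér–Bochner on `ℤ`.** If `a : ℤ → ℝ` is absolutely summable and positive-definite on the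
initial segments, `0 ≤ Σ_{i,j<n} c_i c_j a(j-i)` for every real family `c`, then its cosine transform is
non-negative: `0 ≤ Σ_z cos(kz) a(z)` (`c = cos(k·)` plus `c = sin(k·)`; regroup along `j - i = d`;
divide by `n`; dominated convergence). [folklore] -/
theorem bp_tsum_cos_mul_nonneg {a : ℤ → ℝ} (hsum : Summable fun z : ℤ => |a z|) (k : ℝ)
    (hpd : ∀ (n : ℕ) (c : ℤ → ℝ),
      0 ≤ ∑ i ∈ Finset.range n, ∑ j ∈ Finset.range n, c i * c j * a ((j : ℤ) - i)) :
    0 ≤ ∑' z : ℤ, Real.cos (k * z) * a z := by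
  classical
  set c : ℤ → ℝ := fun d => Real.cos (k * d) * a d with hc
  obtain ⟨N, hN⟩ : ∃ N : ℕ → ℤ → ℕ, ∀ (n : ℕ) (d : ℤ),
      ((Finset.range n ×ˢ Finset.range n).filter
        (fun p : ℕ × ℕ => (p.2 : ℤ) - p.1 = d)).card = N n d := ⟨_, fun _ _ => rfl⟩
  have hN_le : ∀ (n : ℕ) (d : ℤ), (N n d : ℝ) ≤ n := fun n d => by
    rw [← hN]; exact_mod_cast Literature.MathematicalPhysics.KineticTheory.card_filter_sub_eq_le n d
  have hN_ge : ∀ (n : ℕ) (d : ℤ), (n : ℝ) - |(d : ℝ)| ≤ N n d := fun n d => by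
    rw [← hN]; exact Literature.MathematicalPhysics.KineticTheory.sub_abs_le_card_filter_sub_eq n d
  -- Step 1: `Σ_{(i,j)} cos(k(j-i)) a(j-i) ≥ 0` (cosine plus sine quadratic forms)
  have hF : ∀ n : ℕ, 0 ≤ ∑ p ∈ Finset.range n ×ˢ Finset.range n, c ((p.2 : ℤ) - p.1) := by
    intro n
    have h12 := add_nonneg (hpd n fun x => Real.cos (k * x)) (hpd n fun x => Real.sin (k * x))
    rw [← Finset.sum_add_distrib] at h12
    refine h12.trans_eq ?_
    rw [Finset.sum_product]
    refine Finset.sum_congr rfl fun i _ => ?_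
    rw [← Finset.sum_add_distrib]
    refine Finset.sum_congr rfl fun j _ => ?_
    simp only [hc, Int.cast_sub, Int.cast_natCast, mul_sub, Real.cos_sub]
    ring
  -- Step 2: regroup along the fibres `j - i = d`
  have hfib : ∀ n : ℕ, ∑ p ∈ Finset.range n ×ˢ Finset.range n, c ((p.2 : ℤ) - p.1) =
      ∑' d : ℤ, (N n d : ℝ) * c d := by
    intro n
    set s := Finset.range n ×ˢ Finset.range n with hs
    set u : Finset ℤ := Finset.Ioo (-(n : ℤ)) n with hu
    have hmaps : ∀ p ∈ s, ((p.2 : ℤ) - p.1) ∈ u := by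
      intro p hp
      obtain ⟨h1, h2⟩ := Finset.mem_product.1 hp
      have h1' := Finset.mem_range.1 h1
      have h2' := Finset.mem_range.1 h2
      simp only [hu, Finset.mem_Ioo]
      omega
    rw [← Finset.sum_fiberwise_of_maps_to hmaps]
    have hinner : ∀ d ∈ u, ∑ p ∈ s with ((p.2 : ℤ) - p.1 = d), c ((p.2 : ℤ) - p.1) =
        (N n d : ℝ) * c d := by
      intro d _
      rw [Finset.sum_congr rfl (fun p hp => by rw [(Finset.mem_filter.1 hp).2]), Finset.sum_const,
        nsmul_eq_mul, hN]
    rw [Finset.sum_congr rfl hinner]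
    refine (tsum_eq_sum fun d hd => ?_).symm
    have h0 : N n d = 0 := by
      rw [← hN]
      refine Finset.card_eq_zero.2 (Finset.filter_eq_empty_iff.2 fun p hp h => hd ?_)
      exact h ▸ hmaps p hp
    rw [h0, Nat.cast_zero, zero_mul]
  -- Step 3: the Cesàro means are `≥ 0` and tend to `Σ_d c(d)`
  have hG : ∀ n : ℕ, 0 < n → 0 ≤ ∑' d : ℤ, ((N n d : ℝ) / n) * c d := by
    intro n hn
    have h := hF n
    rw [hfib n] at h
    have e : ∑' d : ℤ, ((N n d : ℝ) / n) * c d = (n : ℝ)⁻¹ * ∑' d : ℤ, (N n d : ℝ) * c d := by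
      rw [← tsum_mul_left]
      refine tsum_congr fun d => ?_
      ring
    rw [e]
    exact mul_nonneg (by positivity) h
  have hcs : Summable fun d : ℤ => |c d| := by
    refine Summable.of_nonneg_of_le (fun d => abs_nonneg _) (fun d => ?_) hsum
    simp only [hc, abs_mul]
    exact mul_le_of_le_one_left (abs_nonneg _) (Real.abs_cos_le_one _)
  have hlim : Tendsto (fun n : ℕ => ∑' d : ℤ, ((N n d : ℝ) / n) * c d) atTop (𝓝 (∑' d : ℤ, c d)) := by
    refine tendsto_tsum_of_dominated_convergence (bound := fun d => |c d|) hcs (fun d => ?_) ?_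
    · have hw : Tendsto (fun n : ℕ => (N n d : ℝ) / n) atTop (𝓝 1) := by
        have hlow : Tendsto (fun n : ℕ => 1 - |(d : ℝ)| / n) atTop (𝓝 1) := by
          have h := (tendsto_const_div_atTop_nhds_zero_nat |(d : ℝ)|)
          simpa using (tendsto_const_nhds (x := (1 : ℝ))).sub h
        refine tendsto_of_tendsto_of_tendsto_of_le_of_le' hlow tendsto_const_nhds ?_ ?_
        · filter_upwards [eventually_gt_atTop 0] with n hn
          have hn' : (0 : ℝ) < n := by exact_mod_cast hn
          rw [sub_le_iff_le_add, ← add_div, le_div_iff₀ hn', one_mul]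
          linarith [hN_ge n d]
        · filter_upwards [eventually_gt_atTop 0] with n hn
          have hn' : (0 : ℝ) < n := by exact_mod_cast hn
          rw [div_le_one hn']
          exact hN_le n d
      simpa using hw.mul_const (c d)
    · filter_upwards [eventually_gt_atTop 0] with n hn d
      have hn' : (0 : ℝ) < n := by exact_mod_cast hn
      rw [Real.norm_eq_abs, abs_mul, abs_div, Nat.abs_cast, Nat.abs_cast]
      refine mul_le_of_le_one_left (abs_nonneg _) ?_
      rw [div_le_one hn']
      exact hN_le n d
  exact ge_of_tendsto hlim ((eventually_gt_atTop 0).mono fun n hn => hG n hn)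

/-- Finite double sums of Laplace transforms: `Σ_{x,y∈F} c_x c_y ∫ e^{-νt} S(y-x,t) dt = ∫ e^{-νt} Σ_{x,y} c_x c_y S(y-x,t) dt`
for Laplace-integrable `S(z,·)`. [folklore] -/
theorem bp_sum_sum_mul_integral_exp_neg_mul {S : ℤ → ℝ → ℝ} {ν : ℝ}
    (hInt : ∀ z : ℤ, IntegrableOn (fun t : ℝ => Real.exp (-(ν * t)) * S z t) (Ioi 0))
    (F : Finset ℤ) (c : ℤ → ℝ) :
    ∑ x ∈ F, ∑ y ∈ F, c x * c y * ∫ t in Ioi (0:ℝ), Real.exp (-(ν * t)) * S (y - x) t =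
      ∫ t in Ioi (0:ℝ), Real.exp (-(ν * t)) * ∑ x ∈ F, ∑ y ∈ F, c x * c y * S (y - x) t := by
  have hint : ∀ x y : ℤ, Integrable (fun t : ℝ => Real.exp (-(ν * t)) * (c x * c y * S (y - x) t))
      (volume.restrict (Ioi 0)) := fun x y => by
    refine (Integrable.const_mul (hInt (y - x)) (c x * c y)).congr (Eventually.of_forall fun t => ?_)
    ring
  symm
  calc ∫ t in Ioi (0:ℝ), Real.exp (-(ν * t)) * ∑ x ∈ F, ∑ y ∈ F, c x * c y * S (y - x) t
      = ∫ t in Ioi (0:ℝ), ∑ x ∈ F, ∑ y ∈ F, Real.exp (-(ν * t)) * (c x * c y * S (y - x) t) := by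
        refine integral_congr_ae (Eventually.of_forall fun t => ?_)
        simp only [Finset.mul_sum]
    _ = ∑ x ∈ F, ∑ y ∈ F, ∫ t in Ioi (0:ℝ), Real.exp (-(ν * t)) * (c x * c y * S (y - x) t) := by
        rw [integral_finsetSum _ fun x _ => integrable_finsetSum _ fun y _ => hint x y]
        exact Finset.sum_congr rfl fun x _ => integral_finsetSum _ fun y _ => hint x y
    _ = ∑ x ∈ F, ∑ y ∈ F, c x * c y * ∫ t in Ioi (0:ℝ), Real.exp (-(ν * t)) * S (y - x) t := by
        refine Finset.sum_congr rfl fun x _ => Finset.sum_congr rfl fun y _ => ?_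
        rw [← integral_const_mul]
        refine integral_congr_ae (Eventually.of_forall fun t => ?_)
        ring

/-! ## Autocorrelations along a measure-preserving dynamics of the chain -/

/-- **The Abel mean of an autocorrelation is non-negative.** For `D` preserving the probability measure
`μ`, `g ∈ L⁴(μ)` measurable and continuous along the orbits of the carrier, and `ν > 0`:
`0 ≤ ∫_{(0,∞)} e^{-νt} ∫ g · (g ∘ φ_t) dμ dt` (the autocorrelation is continuous, bounded by `‖g‖₂²`, and of
positive type in the doubly integrated form `integral_Ioc_sub_mul_nonneg`). [folklore] -/
theorem bp_integral_exp_neg_mul_autocorr_nonneg {P : OscillatorChain} (D : InfiniteChainDynamics P)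
    {μ : Measure ChainConfig} [IsProbabilityMeasure μ] (hD : D.PreservesMeasure μ)
    {g : ChainConfig → ℝ} (hgm : Measurable g) (hg4 : MemLp g 4 μ)
    (hcont : ∀ σ ∈ D.carrier, Continuous fun t : ℝ => g (D.flow t σ)) {ν : ℝ} (hν : 0 < ν) :
    0 ≤ ∫ t in Ioi (0:ℝ), Real.exp (-(ν * t)) * ∫ σ, g σ * g (D.flow t σ) ∂μ := by
  have hg2 : MemLp g 2 μ := hg4.mono_exponent (by norm_num)
  have hg4i : Integrable (fun σ => g σ ^ 4) μ := by
    refine (hg4.integrable_norm_pow' (p := 4)).congr (Eventually.of_forall fun σ => ?_)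
    simp only [Real.norm_eq_abs]
    exact Even.pow_abs (by decide) _
  have hFc : Continuous fun t : ℝ => ∫ σ, g σ * g (D.flow t σ) ∂μ :=
    D.continuous_integral_mul_comp_flow hD hgm hgm hg4i hg4i hcont
  exact bp_integral_exp_neg_mul_nonneg hFc ⟨_, fun t => D.abs_integral_mul_comp_flow_le hD hgm hg2 t⟩
    (fun t ht => D.integral_Ioc_sub_mul_nonneg hD hgm hg2 hcont hFc ht) hν

/-- **Shift covariance of the centred energy–energy two-point function.** For a shift-invariant `μ`
preserved by `D` and a flow commuting everywhere with the translations: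
`∫ (h_x - m)((h_y - m) ∘ φ_t) dμ = ∫ (h_0 - m)((h_{y-x} - m) ∘ φ_t) dμ`. [folklore] -/
theorem bp_integral_centred_mul_flow_eq {P : OscillatorChain} (D : InfiniteChainDynamics P)
    {μ : Measure ChainConfig} (hSI : IsShiftInvariant μ) (hD : D.PreservesMeasure μ)
    (hcomm : ∀ (t : ℝ) (x : ℤ) (σ : ChainConfig), D.flow t (chainShift x σ) = chainShift x (D.flow t σ))
    (hUm : Measurable P.U) (hVm : Measurable P.V) (m t : ℝ) (x y : ℤ) :
    ∫ σ, (P.energyDensityZ σ x - m) * (P.energyDensityZ (D.flow t σ) y - m) ∂μ =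
      ∫ σ, (P.energyDensityZ σ 0 - m) * (P.energyDensityZ (D.flow t σ) (y - x) - m) ∂μ := by
  have e : (fun σ => (P.energyDensityZ σ x - m) * (P.energyDensityZ (D.flow t σ) y - m)) =
      fun σ => (fun τ => (P.energyDensityZ τ 0 - m) * (P.energyDensityZ (D.flow t τ) (y - x) - m))
        (chainShift x σ) := by
    funext σ
    simp only [hcomm t x σ, OscillatorChain.energyDensityZ_chainShift, zero_add, sub_add_cancel]
  rw [e]
  exact integral_comp_eq_of_measurePreserving (hSI.measurePreserving_chainShift x)
    (((P.measurable_energyDensityZ hUm hVm 0).sub_const m).mul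
      (((P.measurable_energyDensityZ hUm hVm (y - x)).comp (hD.2 t).measurable).sub_const m))

/-- **Autocorrelation of a finite linear combination** `g = Σ_{x∈F} c_x f_x` of `L²` observables:
`∫ g · (g ∘ φ_t) dμ = Σ_{x,y∈F} c_x c_y ∫ f_x · (f_y ∘ φ_t) dμ`. [folklore] -/
theorem bp_integral_sum_mul_sum_flow {P : OscillatorChain} (D : InfiniteChainDynamics P)
    {μ : Measure ChainConfig} (hD : D.PreservesMeasure μ) {f : ℤ → ChainConfig → ℝ}
    (hf2 : ∀ x, MemLp (f x) 2 μ) (F : Finset ℤ) (c : ℤ → ℝ) (t : ℝ) :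
    ∫ σ, (∑ x ∈ F, c x * f x σ) * (∑ y ∈ F, c y * f y (D.flow t σ)) ∂μ =
      ∑ x ∈ F, ∑ y ∈ F, c x * c y * ∫ σ, f x σ * f y (D.flow t σ) ∂μ := by
  have hint : ∀ x y : ℤ, Integrable (fun σ => c x * f x σ * (c y * f y (D.flow t σ))) μ :=
    fun x y => ((hf2 x).const_mul (c x)).integrable_mul
      (((hf2 y).comp_measurePreserving (hD.2 t)).const_mul (c y))
  simp_rw [Finset.sum_mul_sum]
  rw [integral_finsetSum _ fun x _ => integrable_finsetSum _ fun y _ => hint x y]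
  refine Finset.sum_congr rfl fun x _ => ?_
  rw [integral_finsetSum _ fun y _ => hint x y]
  refine Finset.sum_congr rfl fun y _ => ?_
  rw [← integral_const_mul]
  refine integral_congr_ae (Eventually.of_forall fun σ => ?_)
  ring

/-! ## Positive-definiteness of the Abel escape profile of the pinned chain (canonical dynamics) -/

/-- **Positive-definiteness of `x ↦ S̄_ν(x)`** for the canonical Buttà–Marchioro dynamics of the pinned
chain in its shift-invariant DLR state: for every finite `F ⊆ ℤ` and real family `c`,
`0 ≤ Σ_{x,y∈F} c_x c_y · ν∫₀^∞ e^{-νt} S(y-x,t) dt`, `S(z,t) = ∫ (h_0 - μ(h_0))((h_z - μ(h_0)) ∘ φ_t) dμ`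
(`= ν∫₀^∞ e^{-νt} ∫ g̃ (g̃∘φ_t) dμ dt ≥ 0`, `g̃ = Σ_x c_x (h_x - μ(h_0))`). [folklore] -/
theorem bp_sum_sum_laplace_nonneg {ω₂ lam β γ : ℝ} (hω : 0 < ω₂) (hl : 0 < lam) (hβ : 0 < β)
    {T : ℝ} (hT : 0 < T) {μ : Measure ChainConfig}
    (hG : (pinnedChain ω₂ lam β γ).IsChainGibbsMeasure T μ) (hSI : IsShiftInvariant μ)
    (D : InfiniteChainDynamics (pinnedChain ω₂ lam β γ))
    (hcar : D.carrier = (pinnedChain ω₂ lam β γ).bmGood) (hmeas : ∀ t : ℝ, Measurable (D.flow t))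
    (hid : ∀ t : ℝ, ∀ σ ∉ (pinnedChain ω₂ lam β γ).bmGood, D.flow t σ = σ) {S : ℤ → ℝ → ℝ}
    (hS : S = fun (x : ℤ) (t : ℝ) => ∫ σ, ((pinnedChain ω₂ lam β γ).energyDensityZ σ 0 -
        ∫ σ', (pinnedChain ω₂ lam β γ).energyDensityZ σ' 0 ∂μ) *
      ((pinnedChain ω₂ lam β γ).energyDensityZ (D.flow t σ) x -
        ∫ σ', (pinnedChain ω₂ lam β γ).energyDensityZ σ' 0 ∂μ) ∂μ)
    {ν : ℝ} (hν : 0 < ν)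
    (hInt : ∀ x : ℤ, IntegrableOn (fun t : ℝ => Real.exp (-(ν * t)) * S x t) (Ioi 0))
    (F : Finset ℤ) (c : ℤ → ℝ) :
    0 ≤ ∑ x ∈ F, ∑ y ∈ F, c x * c y * (ν * ∫ t in Ioi (0:ℝ), Real.exp (-(ν * t)) * S (y - x) t) := by
  set m : ℝ := ∫ σ', (pinnedChain ω₂ lam β γ).energyDensityZ σ' 0 ∂μ with hm
  -- chain facts (in tree)
  have hU2 := OscillatorChain.pinnedChain_isEvenPolyOfDegree_U β γ hω.le hl
  have hV2 := OscillatorChain.pinnedChain_isEvenPolyOfDegree_V ω₂ lam γ hβ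
  have hU0 : ∀ r, 0 ≤ (pinnedChain ω₂ lam β γ).U r := OscillatorChain.pinnedChain_U_nonneg β γ hω.le hl.le
  have hV0 : ∀ r, 0 ≤ (pinnedChain ω₂ lam β γ).V r := OscillatorChain.pinnedChain_V_nonneg ω₂ lam γ hβ.le
  have hUm : Measurable (pinnedChain ω₂ lam β γ).U := OscillatorChain.measurable_pinnedChain_U ω₂ lam β γ
  have hVm : Measurable (pinnedChain ω₂ lam β γ).V := OscillatorChain.measurable_pinnedChain_V ω₂ lam β γ
  have hUc : Continuous (pinnedChain ω₂ lam β γ).U := by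
    show Continuous fun q : ℝ => ω₂ * q ^ 2 / 2 + lam * q ^ 4 / 4
    fun_prop
  have hVc : Continuous (pinnedChain ω₂ lam β γ).V := by
    show Continuous fun r : ℝ => r ^ 2 / 2 + β * r ^ 4 / 4
    fun_prop
  have hss : (pinnedChain ω₂ lam β γ).HasSuperstabilityEstimate μ :=
    OscillatorChain.hasSuperstabilityEstimate_of_isShiftInvariant_pinnedChain γ hω hl.le hβ.le hT hG hSI
  haveI : IsProbabilityMeasure μ := hss.1
  have hD : D.PreservesMeasure μ :=
    OscillatorChain.preservesMeasure_of_carrier_eq_bmGood one_le_two one_le_two hU2 hV2 D hcar hmeas hG hss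
  have hcomm : ∀ (t : ℝ) (x : ℤ) (σ : ChainConfig), D.flow t (chainShift x σ) = chainShift x (D.flow t σ) :=
    fun t x σ => D.flow_chainShift_of_eq_id hcar hid hU0 hV0 t x σ
  -- the centred energy densities `f x = h_x - m`
  set f : ℤ → ChainConfig → ℝ := fun x σ => (pinnedChain ω₂ lam β γ).energyDensityZ σ x - m with hf
  have hfm : ∀ x, Measurable (f x) := fun x =>
    ((pinnedChain ω₂ lam β γ).measurable_energyDensityZ hUm hVm x).sub_const m
  have hf4 : ∀ x, MemLp (f x) 4 μ := fun x => by
    have h1 : MemLp (fun σ => (pinnedChain ω₂ lam β γ).energyDensityZ σ x) 4 μ :=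
      OscillatorChain.memLp_energyDensityZ_pinnedChain γ hω.le hl.le hβ.le hss x (by norm_num)
    exact h1.sub (memLp_const m)
  have hf2 : ∀ x, MemLp (f x) 2 μ := fun x => (hf4 x).mono_exponent (by norm_num)
  have hcov : ∀ (t : ℝ) (x y : ℤ), ∫ σ, f x σ * f y (D.flow t σ) ∂μ = S (y - x) t := fun t x y => by
    rw [hS]
    exact bp_integral_centred_mul_flow_eq D hSI hD hcomm hUm hVm m t x y
  -- the observable `g = Σ c_x f_x`
  set g : ChainConfig → ℝ := fun σ => ∑ x ∈ F, c x * f x σ with hg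
  have hgm : Measurable g := Finset.measurable_sum _ fun x _ => (hfm x).const_mul (c x)
  have hg4 : MemLp g 4 μ := memLp_finsetSum _ fun x _ => (hf4 x).const_mul (c x)
  have hgcont : ∀ σ ∈ D.carrier, Continuous fun t : ℝ => g (D.flow t σ) := fun σ hσ =>
    continuous_finsetSum _ fun x _ =>
      ((D.continuous_energyDensityZ_flow hUc hVc hσ x).sub continuous_const).const_mul (c x)
  have hL := bp_integral_exp_neg_mul_autocorr_nonneg D hD hgm hg4 hgcont hν
  have hFa : ∀ t : ℝ, ∫ σ, g σ * g (D.flow t σ) ∂μ = ∑ x ∈ F, ∑ y ∈ F, c x * c y * S (y - x) t := by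
    intro t
    refine (bp_integral_sum_mul_sum_flow D hD hf2 F c t).trans ?_
    simp only [hcov]
  simp only [hFa] at hL
  rw [← bp_sum_sum_mul_integral_exp_neg_mul hInt F c] at hL
  calc (0:ℝ) ≤ ν * ∑ x ∈ F, ∑ y ∈ F, c x * c y * ∫ t in Ioi (0:ℝ), Real.exp (-(ν * t)) * S (y - x) t :=
        mul_nonneg hν.le hL
    _ = _ := by
        rw [Finset.mul_sum]
        refine Finset.sum_congr rfl fun x _ => ?_
        rw [Finset.mul_sum]
        refine Finset.sum_congr rfl fun y _ => ?_
        ring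

/-! ## The registered stub -/

/-- **Stub `stub_bochnerPositivity` (registered signature, verbatim): Bochner positivity of the Abel
escape profile** for the canonical Buttà–Marchioro dynamics of the pinned chain in its shift-invariant DLR
state: `0 ≤ f̂_ν(k) = Σ_x cos(kx) S̄_ν(x)` for `ν > 0` and all `k` (positive-definiteness of `S̄_ν` on `ℤ`,
`bp_sum_sum_laplace_nonneg`, and Fejér, `bp_tsum_cos_mul_nonneg`). The momentum-reversal hypothesis is not
used. [folklore] -/
theorem stub_bochnerPositivity :
    ∀ ω₂ lam β γ : ℝ, 0 < ω₂ → 0 < lam → 0 < β → ∀ T : ℝ, 0 < T →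
    ∀ μ : Measure ChainConfig, (pinnedChain ω₂ lam β γ).IsChainGibbsMeasure T μ → IsShiftInvariant μ →
    μ.map (fun σ : ChainConfig => fun x : ℤ => ((σ x).1, -(σ x).2)) = μ →
    ∀ D : InfiniteChainDynamics (pinnedChain ω₂ lam β γ),
    D.carrier = (pinnedChain ω₂ lam β γ).bmGood → (∀ t : ℝ, Measurable (D.flow t)) →
    (∀ t : ℝ, ∀ σ ∉ (pinnedChain ω₂ lam β γ).bmGood, D.flow t σ = σ) →
    ∀ h : ChainConfig → ℤ → ℝ,
      h = (fun (σ : ChainConfig) (x : ℤ) => (σ x).2 ^ 2 / 2 + (pinnedChain ω₂ lam β γ).U (σ x).1 +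
        ((pinnedChain ω₂ lam β γ).V ((σ (x + 1)).1 - (σ x).1) +
          (pinnedChain ω₂ lam β γ).V ((σ x).1 - (σ (x - 1)).1)) / 2) →
    ∀ S : ℤ → ℝ → ℝ,
      S = (fun (x : ℤ) (t : ℝ) =>
        ∫ σ, (h σ 0 - ∫ σ', h σ' 0 ∂μ) * (h (D.flow t σ) x - ∫ σ', h σ' 0 ∂μ) ∂μ) →
    ∀ Sb : ℝ → ℤ → ℝ,
      Sb = (fun (ν : ℝ) (x : ℤ) => ν * ∫ t in Set.Ioi (0:ℝ), Real.exp (-(ν * t)) * S x t) →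
    (∀ x : ℤ, ∀ ν : ℝ, 0 < ν →
      IntegrableOn (fun t : ℝ => Real.exp (-(ν * t)) * S x t) (Set.Ioi 0)) →
    (∀ ν : ℝ, 0 < ν → Summable (fun x : ℤ => |Sb ν x|)) →
    ∀ fh : ℝ → ℝ → ℝ, fh = (fun (ν k : ℝ) => ∑' x : ℤ, Real.cos (k * (x : ℝ)) * Sb ν x) →
    ∀ ν : ℝ, 0 < ν → ∀ k : ℝ, 0 ≤ fh ν k := by
  intro ω₂ lam β γ hω hl hβ T hT μ hG hSI _hR D hcar hmeas hid h hh S hS Sb hSb hInt hSum fh hfh ν hν k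
  have hh' : h = fun (σ : ChainConfig) (x : ℤ) => (pinnedChain ω₂ lam β γ).energyDensityZ σ x := hh
  subst hh' hfh hSb
  refine bp_tsum_cos_mul_nonneg (hSum ν hν) k fun n c => ?_
  have h := bp_sum_sum_laplace_nonneg hω hl hβ hT hG hSI D hcar hmeas hid hS hν (fun x => hInt x ν hν)
    ((Finset.range n).map Nat.castEmbedding) c
  simpa only [Finset.sum_map, Nat.castEmbedding_apply] using h

end Summit.AtomisticToContinuum.FouriersLaw.Theorems.FibreCalculusSketch

end
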